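import Summits.HodgeConjecture.HodgeConjecture.Theses.TropicalWeilObstruction
import Summits.HodgeConjecture.HodgeConjecture.Theorems.TropicalWeilVanishing.Negative.FalseWithoutIsWeilGeneric
import HarnessLib

/-!
# Route `TropicalWeilObstruction` (Kontsevich's tropical test — NEGATION SINK, exploration, no summit claim):
# flat effective tropical `4`-cycles on the standard torus `ℝ⁸/ℤ⁸` with prescribed frames

Negation-sink bookkeeping of the cell `pub-hodge-tropical` (seat tropical-2). The certificate type
`TropicalTorusCycle 8 4 Q` of effective tropical `4`-cycles had two inhabitants in the tree: the empty cycle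
and the refuter's `kuhnCycle` (p171405: the coordinate subtorus `ℝ⁴/ℤ⁴ × 0 ⊂ ℝ⁸/ℤ⁸`, Kuhn–Freudenthal
triangulated, `24` cells, `60` facet classes). This file turns the latter into a CONSTRUCTOR: for any finite
family of saturated integer `8 × 4` frames `L_j` (left inverses `M_j L_j = 1`) and positive integer weights
`w_j`, `flatCycle L M hM w hw : TropicalTorusCycle 8 4 1` is the weighted sum of the linear `4`-subtori
`ℝL_j / (ℝL_j ∩ ℤ⁸)` of the standard torus (period matrix `Q = 1`), each Kuhn–Freudenthal triangulated
through `L_j` (the combinatorial tables `permTab`, `cls`, `repCell`, `repIdx`, `eps`, `Uz` and the balancing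
identity `balanced_id` of the refuter's file are reused verbatim; the two lattice identities of the
triangulation are re-checked by `decide` in `ℤ⁴` and pushed forward along `L_j`).

* `cyc_flatCycle` — its class is `Σ_j w_j · p_j ⊗ p_j`, `p_j = pluckerCoord L_j` the Plücker vector of the
  frame (each of the `24` simplices of the `j`-th subtorus has frame a column permutation of `L_j` and lattice
  volume `1/4!`): at `Q = 1` EVERY positive integral combination of squares of Plücker vectors of saturated
  frames is the class of an effective tropical `4`-cycle (the converse of "`cyc Z` is a positive combination
  of decomposable squares", which holds at every period by the definition of `cyc`).
* `weilFunctional_flatCycle` — `W = Σ_j w_j η(L_j)²`; `weilMass_flatCycle` — `μ = Σ_j w_j |η(L_j)|²`.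

Use: the class-level sharpness of the calibration cone of p332805 (K1-SCOPE §4B (P), the `κ = 8`
certificate of seat tropical-1) becomes a statement about an EFFECTIVE cycle at `Q = 1` once `206` explicit
frames are fed to this constructor (sibling data file). HONEST STATUS. `Q = 1` is not Weil-generic
(`not_isWeilGeneric_one`), so nothing here touches the open crux K1 (`TropicalWeilVanishing`, stmt-18478) or
the Hodge conjecture. Definitions are the constructor's data (`kv`, `ksz`, `krz`, `fV`, `fF`, `fS`, `fR`,
`fCell`, `flatCycle`); no named fact, no sorry.
References: [MikhalkinZharkov2014Eigenwave] G. Mikhalkin, I. Zharkov, LN UMI 15 (2014), Def. 4.2, Prop. 4.3;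
H. Freudenthal, Simplizialzerlegungen von beschränkter Flachheit, Ann. Math. 43 (1942) [folklore].
-/

set_option linter.dupNamespace false

open scoped BigOperators
open Matrix
open Literature.AlgebraicGeometry.Tropical

namespace Summit.HodgeConjecture.HodgeConjecture.Theorems.TropicalWeilVanishing.FlatCycles

open Negative

/-! ## §1 The Kuhn–Freudenthal triangulation of the `4`-cube, in lattice coordinates `ℤ⁴` -/

/-- Vertex `k` of the Kuhn simplex `π` (cell `σ`): `Σ_{m<k} e_{π m} ∈ ℤ⁴`, i.e. coordinate `j'` is `1` iff
`π⁻¹ j' < k`. [folklore] -/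
def kv (σ : Fin 24) (k : Fin 5) (j' : Fin 4) : ℤ :=
  if ((invTab σ j' : Fin 4) : ℕ) < (k : ℕ) then 1 else 0

/-- Period shift of facet slot `(σ, i)` in lattice coordinates: `e_{π 0}` for `i = 0`, else `0`. [folklore] -/
def ksz (σ : Fin 24) (i : Fin 5) (j' : Fin 4) : ℤ :=
  if (i : ℕ) = 0 ∧ j' = permTab σ 0 then 1 else 0

/-- Reference facet of a facet class, in lattice coordinates (the facet of its representative slot). [folklore] -/
def krz (f : Fin 60) (j : Fin 4) (j' : Fin 4) : ℤ :=
  kv (repCell f) ((repIdx f).succAbove j) j'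

set_option maxRecDepth 200000 in
/-- Facet identity of the triangulation in `ℤ⁴`: the `i`-th facet of simplex `σ` is the reference facet of
its class translated by the period shift; checked by `decide`. [folklore] -/
theorem kuhn_facet_id : ∀ (σ : Fin 24) (i : Fin 5) (j j' : Fin 4),
    kv σ (i.succAbove j) j' = krz (cls σ i) j j' + ksz σ i j' := by
  intro σ; fin_cases σ <;> decide

set_option maxRecDepth 200000 in
/-- Edge identity of the triangulation in `ℤ⁴`: `s_{j+1} - s_0 = Σ_{m ≤ j} e_{π m}`; checked by `decide`.
[folklore] -/
theorem kuhn_vert_id : ∀ (σ : Fin 24) (j j' : Fin 4),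
    kv σ j.succ j' - kv σ 0 j' = ∑ m : Fin 4, if permTab σ m = j' then Uz m j else 0 := by
  intro σ; fin_cases σ <;> decide

/-- `eps σ = ±1`, so `eps σ * eps σ = 1`; checked by `decide`. [folklore] -/
theorem eps_mul_self : ∀ σ : Fin 24, eps σ * eps σ = 1 := by decide

/-! ## §2 Pushing the triangulation forward along a frame `L : ℤ⁴ → ℤ⁸` -/

section Frame

variable (Lj : Matrix (Fin (2 * 4)) (Fin 4) ℤ)

/-- Vertex `k` of cell `σ` of the subtorus through `L`: `L · (Σ_{m<k} e_{π m})`. [folklore] -/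
def fV (σ : Fin 24) (k : Fin 5) (a : Fin (2 * 4)) : ℤ := ∑ j', Lj a j' * kv σ k j'

/-- Frame of cell `σ`: the columns of `L` permuted by `π`. [folklore] -/
def fF (σ : Fin 24) : Matrix (Fin (2 * 4)) (Fin 4) ℤ := fun a m => Lj a (permE σ m)

/-- Period shift of facet slot `(σ, i)`: `L e_{π 0}` for `i = 0`, else `0`. [folklore] -/
def fS (σ : Fin 24) (i : Fin 5) (a : Fin (2 * 4)) : ℤ := ∑ j', Lj a j' * ksz σ i j'

/-- Reference facet of facet class `f` of the subtorus through `L`. [folklore] -/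
def fR (f : Fin 60) (j : Fin 4) (a : Fin (2 * 4)) : ℤ := ∑ j', Lj a j' * krz f j j'

/-- Facet identity, pushed forward along `L`. [folklore] -/
theorem fV_succAbove (σ : Fin 24) (i : Fin 5) (j : Fin 4) (a : Fin (2 * 4)) :
    fV Lj σ (i.succAbove j) a = fR Lj (cls σ i) j a + fS Lj σ i a := by
  simp only [fV, fR, fS, kuhn_facet_id, mul_add, Finset.sum_add_distrib]

/-- Edge identity, pushed forward along `L`: `v_{j+1} - v_0 = Σ_m (L∘π)_m · U_{m j}`. [folklore] -/
theorem fV_succ_sub (σ : Fin 24) (j : Fin 4) (a : Fin (2 * 4)) :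
    fV Lj σ j.succ a - fV Lj σ 0 a = ∑ m : Fin 4, fF Lj σ a m * Uz m j := by
  simp only [fV, fF]
  rw [← Finset.sum_sub_distrib]
  calc ∑ j', (Lj a j' * kv σ j.succ j' - Lj a j' * kv σ 0 j')
      = ∑ j', Lj a j' * ∑ m : Fin 4, (if permTab σ m = j' then Uz m j else 0) := by
        refine Finset.sum_congr rfl fun j' _ => ?_
        rw [← mul_sub, kuhn_vert_id]
    _ = ∑ m : Fin 4, ∑ j', Lj a j' * (if permTab σ m = j' then Uz m j else 0) := by
        simp only [Finset.mul_sum]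
        rw [Finset.sum_comm]
    _ = ∑ m : Fin 4, Lj a (permE σ m) * Uz m j := by
        refine Finset.sum_congr rfl fun m _ => ?_
        simp only [mul_ite, mul_zero, Finset.sum_ite_eq, Finset.mem_univ, if_true]
        rfl

/-- Plücker coordinates of the permuted frame: `[L∘π]_S = sgn π · [L]_S`. [folklore] -/
theorem pluckerCoord_fF (σ : Fin 24) (S : Fin 4 → Fin (2 * 4)) :
    pluckerCoord (fF Lj σ) S = eps σ * pluckerCoord Lj S := by
  have h : (fF Lj σ).submatrix S id = (Lj.submatrix S id).submatrix id (permE σ) := rfl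
  rw [pluckerCoord, pluckerCoord, h, Matrix.det_permute']
  simp [sign_permE]

/-- The complex `dz`-minor of the permuted frame: `η(L∘π) = sgn π · η(L)`. [cite: Zharkov2020TropicalWeil, §2] -/
theorem frameComplexDet_fF (σ : Fin 24) :
    frameComplexDet 4 (fF Lj σ) = (eps σ : ℂ) * frameComplexDet 4 Lj := by
  unfold frameComplexDet
  have h : (Matrix.of fun k j : Fin 4 =>
        ((fF Lj σ ⟨(k : ℕ), by omega⟩ j : ℤ) : ℂ) + ((fF Lj σ ⟨(k : ℕ) + 4, by omega⟩ j : ℤ) : ℂ) * Complex.I) =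
      (Matrix.of fun k j : Fin 4 =>
        ((Lj ⟨(k : ℕ), by omega⟩ j : ℤ) : ℂ) + ((Lj ⟨(k : ℕ) + 4, by omega⟩ j : ℤ) : ℂ) * Complex.I).submatrix
        id (permE σ) := rfl
  rw [h, Matrix.det_permute']
  have hs := sign_permE σ
  rw [show (((Equiv.Perm.sign (permE σ) : ℤˣ) : ℤ) : ℂ) = (eps σ : ℂ) by rw [hs]]

/-- The permuted left inverse is a left inverse of the permuted frame (saturation). [folklore] -/
theorem leftinv_fF (Mj : Matrix (Fin 4) (Fin (2 * 4)) ℤ) (hMj : Mj * Lj = 1) (σ : Fin 24) :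
    (Matrix.of fun m b => Mj (permE σ m) b) * fF Lj σ = 1 := by
  ext m m'
  have h := congrFun (congrFun hMj (permE σ m)) (permE σ m')
  rw [Matrix.mul_apply] at h ⊢
  simp only [Matrix.of_apply, fF]
  rw [h, Matrix.one_apply, Matrix.one_apply]
  simp [(permE σ).injective.eq_iff]

/-- Cell `σ` of the Kuhn-triangulated subtorus through `L`, with weight `w`. [folklore] -/
noncomputable def fCell (Mj : Matrix (Fin 4) (Fin (2 * 4)) ℤ) (hMj : Mj * Lj = 1) (wj : ℕ) (hwj : 0 < wj)
    (σ : Fin 24) : TropicalCell (2 * 4) 4 where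
  weight := wj
  weight_pos := hwj
  vertex := fun k a => (fV Lj σ k a : ℝ)
  frame := fF Lj σ
  edgeCoeff := Uz.map (Int.cast : ℤ → ℝ)
  vertex_succ_sub := by
    intro j a
    have h := congrArg (Int.cast : ℤ → ℝ) (fV_succ_sub Lj σ j a)
    push_cast at h
    simpa [Matrix.map_apply] using h
  edgeCoeff_det_pos := by
    rw [← Int.cast_det, Uz_det]
    norm_num
  frame_saturated := ⟨Matrix.of fun m b => Mj (permE σ m) b, leftinv_fF Lj Mj hMj σ⟩

/-- Each cell has lattice volume `1/4!`. [folklore] -/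
theorem latticeVolume_fCell (Mj : Matrix (Fin 4) (Fin (2 * 4)) ℤ) (hMj : Mj * Lj = 1) (wj : ℕ)
    (hwj : 0 < wj) (σ : Fin 24) : (fCell Lj Mj hMj wj hwj σ).latticeVolume = 1 / 24 := by
  simp only [TropicalCell.latticeVolume, fCell]
  rw [← Int.cast_det, Uz_det]
  norm_num [Nat.factorial]

end Frame

/-! ## §3 The weighted sum of flat subtori as one effective tropical `4`-cycle at `Q = 1` -/

section Cycle

variable {N : ℕ}

/-- **The flat cycle with frames `L_j` and weights `w_j`** on the standard torus `ℝ⁸/ℤ⁸`: cells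
`(j, σ) ∈ Fin N × S₄` (coded by `finProdFinEquiv`), facet classes `(j, f) ∈ Fin N × Fin 60`, all facet
permutations `1`. [cite: MikhalkinZharkov2014Eigenwave, Def. 4.2, Prop. 4.3] [folklore] -/
noncomputable def flatCycle (L : Fin N → Matrix (Fin (2 * 4)) (Fin 4) ℤ)
    (M : Fin N → Matrix (Fin 4) (Fin (2 * 4)) ℤ) (hM : ∀ j, M j * L j = 1) (w : Fin N → ℕ) (hw : ∀ j, 0 < w j) :
    TropicalTorusCycle (2 * 4) 4 (1 : Matrix (Fin (2 * 4)) (Fin (2 * 4)) ℝ) where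
  numCells := N * 24
  cell := fun c => fCell (L (finProdFinEquiv.symm c).1) (M (finProdFinEquiv.symm c).1)
    (hM (finProdFinEquiv.symm c).1) (w (finProdFinEquiv.symm c).1) (hw (finProdFinEquiv.symm c).1)
    (finProdFinEquiv.symm c).2
  numFacetClasses := N * 60
  refFacet := fun f' j a => (fR (L (finProdFinEquiv.symm f').1) (finProdFinEquiv.symm f').2 j a : ℝ)
  facetClass := fun c i => finProdFinEquiv ((finProdFinEquiv.symm c).1, cls (finProdFinEquiv.symm c).2 i)
  facetPerm := fun _ _ => 1
  facetShift := fun c i => fS (L (finProdFinEquiv.symm c).1) (finProdFinEquiv.symm c).2 i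
  facet_eq := by
    intro c i j a
    have h := congrArg (Int.cast : ℤ → ℝ)
      (fV_succAbove (L (finProdFinEquiv.symm c).1) (finProdFinEquiv.symm c).2 i j a)
    push_cast at h
    simp only [Equiv.Perm.one_apply, Matrix.one_apply, boole_mul, Finset.sum_ite_eq, Finset.mem_univ,
      if_true, Equiv.symm_apply_apply]
    simpa [fCell] using h
  balanced := by
    intro f' S
    -- reindex the cells by `(j, σ)`; only `j = j₀` contributes, and there the refuter's `balanced_id` applies
    rw [← finProdFinEquiv.sum_comp, Fintype.sum_prod_type]
    simp only [Equiv.symm_apply_apply]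
    have key : ∀ (j : Fin N) (σ : Fin 24) (i : Fin (4 + 1)),
        (if finProdFinEquiv (j, cls σ i) = f' then
            ((fCell (L j) (M j) (hM j) (w j) (hw j) σ).weight : ℤ) * (-1) ^ (i : ℕ) *
              ((Equiv.Perm.sign (1 : Equiv.Perm (Fin 4)) : ℤˣ) : ℤ) *
              pluckerCoord (fCell (L j) (M j) (hM j) (w j) (hw j) σ).frame S
          else 0) =
          (if j = (finProdFinEquiv.symm f').1 then (w j : ℤ) * pluckerCoord (L j) S else 0) *
            (if cls σ i = (finProdFinEquiv.symm f').2 then (-1 : ℤ) ^ (i : ℕ) * eps σ else 0) := by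
      intro j σ i
      have e : finProdFinEquiv (j, cls σ i) = f' ↔
          (j = (finProdFinEquiv.symm f').1 ∧ cls σ i = (finProdFinEquiv.symm f').2) := by
        rw [Equiv.apply_eq_iff_eq_symm_apply, Prod.ext_iff]
      by_cases hj : j = (finProdFinEquiv.symm f').1
      · by_cases hc : cls σ i = (finProdFinEquiv.symm f').2
        · rw [if_pos (e.mpr ⟨hj, hc⟩), if_pos hj, if_pos hc]
          simp only [fCell, Equiv.Perm.sign_one, Units.val_one, mul_one, pluckerCoord_fF]
          ring
        · rw [if_neg (fun h => hc (e.mp h).2), if_neg hc, mul_zero]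
      · rw [if_neg (fun h => hj (e.mp h).1), if_neg hj, zero_mul]
    simp_rw [key, ← Finset.mul_sum, balanced_id, mul_zero, Finset.sum_const_zero]

/-- **Class of the flat cycle: `Σ_j w_j · p_j ⊗ p_j`**, `p_j` the Plücker vector of `L_j`.
[cite: MikhalkinZharkov2014Eigenwave, Prop. 4.3] -/
theorem cyc_flatCycle (L : Fin N → Matrix (Fin (2 * 4)) (Fin 4) ℤ)
    (M : Fin N → Matrix (Fin 4) (Fin (2 * 4)) ℤ) (hM : ∀ j, M j * L j = 1) (w : Fin N → ℕ) (hw : ∀ j, 0 < w j) (S S' : Fin 4 → Fin (2 * 4)) :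
    (flatCycle L M hM w hw).cyc S S' =
      ∑ j, (w j : ℝ) * (((pluckerCoord (L j) S * pluckerCoord (L j) S' : ℤ)) : ℝ) := by
  unfold TropicalTorusCycle.cyc
  show (∑ c : Fin (N * 24), _) = _
  rw [← finProdFinEquiv.sum_comp, Fintype.sum_prod_type]
  refine Finset.sum_congr rfl fun j _ => ?_
  simp only [Equiv.symm_apply_apply, flatCycle, latticeVolume_fCell]
  simp only [fCell, pluckerCoord_fF, Int.cast_mul]
  have h1 : ∀ σ : Fin 24, ((eps σ : ℤ) : ℝ) * ((eps σ : ℤ) : ℝ) = 1 := fun σ => by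
    exact_mod_cast eps_mul_self σ
  calc ∑ σ : Fin 24, (w j : ℝ) * (1 / 24) * ((eps σ : ℝ) * (pluckerCoord (L j) S : ℝ)) *
        ((eps σ : ℝ) * (pluckerCoord (L j) S' : ℝ))
      = ∑ σ : Fin 24, (1 / 24 : ℝ) * ((w j : ℝ) * ((pluckerCoord (L j) S : ℝ) * (pluckerCoord (L j) S' : ℝ))) *
          (((eps σ : ℤ) : ℝ) * ((eps σ : ℤ) : ℝ)) := by
        refine Finset.sum_congr rfl fun σ _ => ?_; ring
    _ = (w j : ℝ) * ((pluckerCoord (L j) S : ℝ) * (pluckerCoord (L j) S' : ℝ)) := by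
        simp only [h1, mul_one, Finset.sum_const, Finset.card_univ, Fintype.card_fin, nsmul_eq_mul]
        ring

/-- **Weil functional of the flat cycle: `W = Σ_j w_j η(L_j)²`.** [cite: Zharkov2020TropicalWeil, §2] -/
theorem weilFunctional_flatCycle (L : Fin N → Matrix (Fin (2 * 4)) (Fin 4) ℤ)
    (M : Fin N → Matrix (Fin 4) (Fin (2 * 4)) ℤ) (hM : ∀ j, M j * L j = 1) (w : Fin N → ℕ) (hw : ∀ j, 0 < w j) :
    weilFunctional (flatCycle L M hM w hw) = ∑ j, (w j : ℂ) * frameComplexDet 4 (L j) ^ 2 := by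
  unfold weilFunctional
  show (∑ c : Fin (N * 24), _) = _
  rw [← finProdFinEquiv.sum_comp, Fintype.sum_prod_type]
  refine Finset.sum_congr rfl fun j _ => ?_
  simp only [Equiv.symm_apply_apply, flatCycle, latticeVolume_fCell]
  simp only [fCell, frameComplexDet_fF]
  have h1 : ∀ σ : Fin 24, ((eps σ : ℤ) : ℂ) * ((eps σ : ℤ) : ℂ) = 1 := fun σ => by
    exact_mod_cast eps_mul_self σ
  calc ∑ σ : Fin 24, (w j : ℂ) * (((1 / 24 : ℝ)) : ℂ) * ((eps σ : ℂ) * frameComplexDet 4 (L j)) ^ 2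
      = ∑ σ : Fin 24, (((1 / 24 : ℝ)) : ℂ) * ((w j : ℂ) * frameComplexDet 4 (L j) ^ 2) *
          (((eps σ : ℤ) : ℂ) * ((eps σ : ℤ) : ℂ)) := by
        refine Finset.sum_congr rfl fun σ _ => ?_; ring
    _ = (w j : ℂ) * frameComplexDet 4 (L j) ^ 2 := by
        simp only [h1, mul_one, Finset.sum_const, Finset.card_univ, Fintype.card_fin, nsmul_eq_mul]
        push_cast
        ring

/-- **Mass of the flat cycle: `μ = Σ_j w_j |η(L_j)|²`.** [cite: Zharkov2020TropicalWeil, §2] -/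
theorem weilMass_flatCycle (L : Fin N → Matrix (Fin (2 * 4)) (Fin 4) ℤ)
    (M : Fin N → Matrix (Fin 4) (Fin (2 * 4)) ℤ) (hM : ∀ j, M j * L j = 1) (w : Fin N → ℕ) (hw : ∀ j, 0 < w j) :
    (∑ c, (((flatCycle L M hM w hw).cell c).weight : ℝ) * ((flatCycle L M hM w hw).cell c).latticeVolume *
        ‖frameComplexDet 4 ((flatCycle L M hM w hw).cell c).frame‖ ^ 2) =
      ∑ j, (w j : ℝ) * ‖frameComplexDet 4 (L j)‖ ^ 2 := by
  show (∑ c : Fin (N * 24), _) = _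
  rw [← finProdFinEquiv.sum_comp, Fintype.sum_prod_type]
  refine Finset.sum_congr rfl fun j _ => ?_
  simp only [Equiv.symm_apply_apply, flatCycle, latticeVolume_fCell]
  simp only [fCell, frameComplexDet_fF, norm_mul]
  have h1 : ∀ σ : Fin 24, ‖((eps σ : ℤ) : ℂ)‖ ^ 2 = 1 := fun σ => by
    rw [Complex.norm_intCast, sq_abs, sq]
    exact_mod_cast eps_mul_self σ
  calc ∑ σ : Fin 24, (w j : ℝ) * (1 / 24) * (‖((eps σ : ℤ) : ℂ)‖ * ‖frameComplexDet 4 (L j)‖) ^ 2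
      = ∑ σ : Fin 24, (1 / 24 : ℝ) * ((w j : ℝ) * ‖frameComplexDet 4 (L j)‖ ^ 2) *
          ‖((eps σ : ℤ) : ℂ)‖ ^ 2 := by
        refine Finset.sum_congr rfl fun σ _ => ?_; ring
    _ = (w j : ℝ) * ‖frameComplexDet 4 (L j)‖ ^ 2 := by
        simp only [h1, mul_one, Finset.sum_const, Finset.card_univ, Fintype.card_fin, nsmul_eq_mul]
        ring

end Cycle

end Summit.HodgeConjecture.HodgeConjecture.Theorems.TropicalWeilVanishing.FlatCycles
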